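import Summits.AnomalousDissipation.AnomalousDissipation.Theorems.SolenoidalFractalHomogenisationLagrangianStepSidebandLadderCoercive
import Summits.AnomalousDissipation.AnomalousDissipation.Theorems.SolenoidalFractalHomogenisationLagrangianStepLadderHypocoerciveOdd
import Summits.AnomalousDissipation.AnomalousDissipation.Theorems.SolenoidalFractalHomogenisationLagrangianStepSidebandOwnSlot
import HarnessLib

/-!
# K1L_D `stub_D1_V0thg` (stmt-AnomalousDissipation-27980), R3′ lane «SidebandTailCrushing» (tenure D28-16 (3) / D28-20) — file F4e:
# LADDER DECAY — the hypocoercivity lemma INSTANTIATED on a hopping ladder of the truncated sideband system during one slot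

Helper file of route `SolenoidalFractalHomogenisation` (prover seat `ad-k1l-cellLawV-w1` g10; plan memo
`Cruxes/LagrangianRenormalisationStepDesign/Lines/onelevel-vtheta-R3-plan.md` §4; `--supports stmt-AnomalousDissipation-27980 --as helper`).
`ladder_decay` applies `LadderCrush.hypocoercive_decay_started''` (file F1d, non-symmetric damping) with `F = Space R` (real inner product), `V = ladderSub R (ladder z₀ mᵢ)`,
`K = indexL`, `H = hopL`, `C = K H − H K`, `B t = envᵢ(t) • H`, `D = dampL`, `G = envᵢ`, discharging h1 (`inner_dampL_ge_indexL`), h2 (`inner_dampL_bond_le`),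
h3 (`norm_sq_bond_le`), h4 (`inner_indexL_commutator_ge`, scaled by the envelope), h5 (`coercive_ladder`), the skewness of `hopL`, the symmetry of `C`, `[K, dampL] = 0`,
positivity of `⟪dampL u, u⟫` (`real_inner_dampL_nonneg_all`) and the slot identity `gen = envᵢ•hopL − dampL`.  What stays a HYPOTHESIS here (discharged downstream):
the odd-damping allowance h6 in sideband form (`hodd`; zero for a major-symmetric viscosity, `≤ O(β₀)` under `Torus.OddSmall`), the trajectory's membership in the
ladder subspace (`huV`; invariance lemma to follow), and the eight-plus-four polynomial parameter constraints (the rate arithmetic `lam ≳ lo'^{2/3}Gm^{1/3}` is file F5).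
No definitions, no sorry.  NOT a proof of `stub_D1_V0thg`, of K1L_D or of AD; rung F-D1.A0 infrastructure.
-/

set_option linter.dupNamespace false -- single-conjunct summit: `Summit.AnomalousDissipation.AnomalousDissipation.…` is the mandated namespace

noncomputable section

namespace Summit.AnomalousDissipation.AnomalousDissipation.Theorems.SolenoidalFractalHomogenisation.LagrangianStep.Sideband

open Set Complex
open scoped InnerProductSpace
open Literature.Analysis Literature.Analysis.FunctionSpaces Literature.Analysis.FunctionSpaces.Torus
open Literature.Analysis.FluidPDE Literature.Analysis.FluidPDE.Torus Literature.Analysis.FluidPDE.LatticeShear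
open Summit.AnomalousDissipation.AnomalousDissipation.Theorems.SolenoidalFractalHomogenisation.LagrangianStep.CellChain
  (linkCoeff kdot_transversalProj' inner_transversalProj_left_of_kdot_eq_zero norm_transversalProj_le)

variable {k₀ : ℕ}

/-! ## §1 The damping form is nonnegative on every state -/

/-- **`⟪dampL u, u⟫_ℝ ≥ 0` for EVERY state** (`NearIso 𝔸 lo' hi'`, `lo' ≥ 0`, `γ₁ ≥ 0`): transversal parts are damped by the symbol, longitudinal parts by `γ₁`.
[cite: Giaquinta1983MultipleIntegrals, Ch. III §2 eq. (2.2)] -/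
theorem real_inner_dampL_nonneg_all {R : ℕ} {𝔸 : Torus.Visc4 (Fin 3)} {lo' hi' : ℝ} (h𝔸 : Torus.NearIso 𝔸 lo' hi') (hlo' : 0 ≤ lo')
    {γ₁ : ℝ} (hγ₁ : 0 ≤ γ₁) (u : Space R) : 0 ≤ ⟪dampL 𝔸 γ₁ R u, u⟫_ℝ := by
  rw [real_inner_space_eq_sum]
  refine Finset.sum_nonneg fun z _ => ?_
  rw [dampL_apply, dampComp_apply, inner_add_left, inner_smul_left, inner_smul_left, Complex.add_re, Complex.conj_ofReal,
    Complex.conj_ofReal, Complex.re_ofReal_mul, Complex.re_ofReal_mul, re_inner_sub_transversalProj]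
  have h1 := re_inner_transversalProj_symbT_ge h𝔸 hlo' (ne_zero_of_mem_box z.2) (u z)
  have h2 : ‖transversalProj z.1 (u z)‖ ^ 2 ≤ ‖u z‖ ^ 2 := pow_le_pow_left₀ (norm_nonneg _) (norm_transversalProj_le _ _) 2
  have h3 : 0 ≤ lo' * ‖transversalProj z.1 (u z)‖ ^ 2 := by positivity
  nlinarith [Real.pi_pos]

/-! ## §2 The instantiated decay estimate -/

set_option maxHeartbeats 400000 in -- pre-budgeted (ops-buildfix rule): many hypotheses to thread
/-- **LADDER DECAY (hypocoercivity on a hopping ladder during one slot).**  Let `u` solve `u′ = gen(t) u` on `[t₀, t₁]` inside slot `i`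
(all other envelopes off, `envᵢ(t) ∈ [Gm, GM]`, `Gm ≥ 0`), staying in the ladder subspace of a hopping ladder `z₀ + ℤmᵢ` (`êᵢ·z₀ ≠ 0`) of a box of radius
`R > M ≥ ‖mᵢ‖_∞`, with `NearIso 𝔸 lo' hi'`, `lo' > 0`, `γ₁ ≥ 0`, and let the odd-damping allowance (h6) hold with constants `η₂, η₃`.  Then for all parameters
`α, β > 0`, `lam ≥ 0`, `ε > 0`, `0 < δ₁ ≤ t₁ − t₀` satisfying the polynomial constraints of `LadderCrush.hypocoercive_decay''` with the ladder constants
`lo₁ = 4π²lo'/7`, `A = 4a²`, `CJ = 8a²(1+|mᵢ|²)|hi'|/lo'`, `η₀ = GM·2a²·3/((R−M)4π²lo')`, `η₁ = 0`, `(U₁,U₂,U₃)` from `coercive_ladder`: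
`‖u t₁‖² ≤ 3(1 + α/(2δ₁lo₁))·exp(−lam(t₁−t₀−δ₁))·‖u t₀‖²`. [cite: BedrossianCotiZelati2017, §2 (hypocoercivity, enhanced dissipation)] -/
theorem ladder_decay (W₁ : LatticeWord k₀) {R : ℕ} (i : Fin k₀) (z₀ : Fin 3 → ℤ)
    (hhop : ∑ a, (W₁.phase i).e a * (z₀ a : ℝ) ≠ 0) {M : ℝ} (hM : ∀ j, |((W₁.phase i).m j : ℝ)| ≤ M) (hMR : M < R)
    {𝔸 : Torus.Visc4 (Fin 3)} {lo' hi' : ℝ} (h𝔸 : Torus.NearIso 𝔸 lo' hi') (hlo' : 0 < lo') (hhi : 0 < hi') {γ₁ : ℝ} (hγ₁ : 0 ≤ γ₁)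
    {u : ℝ → Space R} {t₀ t₁ δ₁ : ℝ} (hδ : 0 < δ₁) (hδt : t₀ + δ₁ ≤ t₁)
    (hu : ∀ t ∈ Icc t₀ t₁, HasDerivAt u (((gen W₁ 𝔸 γ₁ R t).restrictScalars ℝ) (u t)) t)
    (huV : ∀ t ∈ Icc t₀ t₁, u t ∈ ladderSub R (ladder z₀ (W₁.phase i).m))
    (hoff : ∀ t ∈ Icc t₀ t₁, ∀ j, j ≠ i → slotEnvelope W₁ j t = 0)
    {Gm GM : ℝ} (hG : ∀ t ∈ Icc t₀ t₁, Gm ≤ slotEnvelope W₁ i t ∧ slotEnvelope W₁ i t ≤ GM) (hGm : 0 ≤ Gm)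
    {η₂ η₃ : ℝ}
    (hodd : ∀ y ∈ ladderSub R (ladder z₀ (W₁.phase i).m),
      (⟪dampL 𝔸 γ₁ R y, (indexL R (W₁.phase i).m (hopL W₁ R i (indexL R (W₁.phase i).m y)) -
          hopL W₁ R i (indexL R (W₁.phase i).m (indexL R (W₁.phase i).m y)))⟫_ℝ -
        ⟪dampL 𝔸 γ₁ R (indexL R (W₁.phase i).m (hopL W₁ R i (indexL R (W₁.phase i).m y)) -
          hopL W₁ R i (indexL R (W₁.phase i).m (indexL R (W₁.phase i).m y))), y⟫_ℝ) +
      (⟪dampL 𝔸 γ₁ R (indexL R (W₁.phase i).m y), indexL R (W₁.phase i).m (hopL W₁ R i y) - hopL W₁ R i (indexL R (W₁.phase i).m y)⟫_ℝ -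
        ⟪dampL 𝔸 γ₁ R (indexL R (W₁.phase i).m (hopL W₁ R i y) - hopL W₁ R i (indexL R (W₁.phase i).m y)), indexL R (W₁.phase i).m y⟫_ℝ) ≤
      η₂ * ⟪dampL 𝔸 γ₁ R y, y⟫_ℝ + η₃ * ⟪dampL 𝔸 γ₁ R (indexL R (W₁.phase i).m y), indexL R (W₁.phase i).m y⟫_ℝ)
    {α β lam ε : ℝ} (hα : 0 < α) (hβ : 0 < β) (hlam : 0 ≤ lam) (hε : 0 < ε)
    (P1 : 4 * (4 * (2 * Real.pi * |∑ a, (W₁.phase i).e a * (z₀ a : ℝ)| * ‖slotAmp W₁ i‖) ^ 2) * β ^ 2 ≤ α)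
    (P2 : 16 * (8 * (2 * Real.pi * |∑ a, (W₁.phase i).e a * (z₀ a : ℝ)| * ‖slotAmp W₁ i‖) ^ 2 * (1 + freqNormSq (W₁.phase i).m) * |hi'| / lo') * β ^ 2 ≤ α)
    (P3 : 2 * α ^ 2 * GM ^ 2 ≤ β * Gm * (4 * Real.pi ^ 2 * lo' / 7))
    (P4 : 16 * β * (GM * (2 * (2 * Real.pi * |∑ a, (W₁.phase i).e a * (z₀ a : ℝ)| * ‖slotAmp W₁ i‖) ^ 2 * 3 / (((R : ℝ) - M) * (4 * Real.pi ^ 2 * lo')))) ≤ 1)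
    (P4c : 16 * β * η₂ ≤ 1) (P4d : 8 * β * η₃ ≤ α)
    (P5 : 6 * lam * α ≤ 4 * Real.pi ^ 2 * lo' / 7)
    (P6 : 6 * lam * ((1 + freqNormSq (W₁.phase i).m) / (4 * (2 * Real.pi * |∑ a, (W₁.phase i).e a * (z₀ a : ℝ)| * ‖slotAmp W₁ i‖) ^ 2) * (2 * ε))
      ≤ 4 * Real.pi ^ 2 * lo' / 7)
    (P7 : 6 * lam * ((1 + freqNormSq (W₁.phase i).m) / (4 * (2 * Real.pi * |∑ a, (W₁.phase i).e a * (z₀ a : ℝ)| * ‖slotAmp W₁ i‖) ^ 2) *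
      (2 * (2 * Real.pi * |∑ a, (W₁.phase i).e a * (z₀ a : ℝ)| * ‖slotAmp W₁ i‖) ^ 2 * 3 / (((R : ℝ) - M) * (4 * Real.pi ^ 2 * lo')) +
        4 * (2 * Real.pi * |∑ a, (W₁.phase i).e a * (z₀ a : ℝ)| * ‖slotAmp W₁ i‖) ^ 2 / (4 * Real.pi ^ 2 * lo' * ((R : ℝ) - M) ^ 2))) ≤ 1)
    (P8 : 3 * lam * ((1 + freqNormSq (W₁.phase i).m) / (4 * (2 * Real.pi * |∑ a, (W₁.phase i).e a * (z₀ a : ℝ)| * ‖slotAmp W₁ i‖) ^ 2) *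
      (2 + 2 * (2 * Real.pi * |∑ a, (W₁.phase i).e a * (z₀ a : ℝ)| * ‖slotAmp W₁ i‖) ^ 2 / ε)) ≤ 2 * β * Gm) :
    ‖u t₁‖ ^ 2 ≤ 3 * (1 + α / (2 * δ₁ * (4 * Real.pi ^ 2 * lo' / 7))) * Real.exp (-(lam * (t₁ - t₀ - δ₁))) * ‖u t₀‖ ^ 2 := by
  -- abbreviation for the bond modulus (rewritten only where needed)
  obtain ⟨a, ha⟩ : ∃ a : ℝ, a = 2 * Real.pi * |∑ a, (W₁.phase i).e a * (z₀ a : ℝ)| * ‖slotAmp W₁ i‖ := ⟨_, rfl⟩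
  rw [← ha] at P1 P2 P4 P6 P7 P8
  have hm0 : (W₁.phase i).m ≠ 0 := (W₁.phase i).m_ne
  have hRM : 0 < (R : ℝ) - M := by linarith
  have ha0 : 0 < a := by
    have h1 : 0 < |∑ a, (W₁.phase i).e a * (z₀ a : ℝ)| := abs_pos.2 hhop
    have h2 : 0 < ‖slotAmp W₁ i‖ := by rw [norm_slotAmp]; have := norm_latticeVec_pos (W₁.phase i); positivity
    rw [ha]; positivity
  -- the players as real operators
  let K : Space R →L[ℝ] Space R := (indexL R (W₁.phase i).m).restrictScalars ℝ
  let H : Space R →L[ℝ] Space R := (hopL W₁ R i).restrictScalars ℝ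
  let C : Space R →L[ℝ] Space R := K.comp H - H.comp K
  let B : ℝ → (Space R →L[ℝ] Space R) := fun t => (slotEnvelope W₁ i t) • H
  let D : ℝ → (Space R →L[ℝ] Space R) := fun _ => (dampL 𝔸 γ₁ R).restrictScalars ℝ
  have hKapp : ∀ y, K y = indexL R (W₁.phase i).m y := fun y => rfl
  have hHapp : ∀ y, H y = hopL W₁ R i y := fun y => rfl
  have hCapp : ∀ y, C y = indexL R (W₁.phase i).m (hopL W₁ R i y) - hopL W₁ R i (indexL R (W₁.phase i).m y) := fun y => by
    -- `rfl` through the subtraction of continuous linear maps is a whnf trap here; rewrite with the `rfl`-lemmas instead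
    simp only [C, K, H, sub_apply, ContinuousLinearMap.coe_comp, Function.comp_apply,
      ContinuousLinearMap.coe_restrictScalars']
  have hBapp : ∀ t y, B t y = (slotEnvelope W₁ i t) • hopL W₁ R i y := fun t y => rfl
  have hDapp : ∀ t y, D t y = dampL 𝔸 γ₁ R y := fun t y => rfl
  -- structural hypotheses
  have hKs : ∀ y v : Space R, ⟪indexL R (W₁.phase i).m y, v⟫_ℝ = ⟪y, indexL R (W₁.phase i).m v⟫_ℝ := fun y v => real_inner_diagL_comm R _ y v
  have hHs : ∀ y v : Space R, ⟪hopL W₁ R i y, v⟫_ℝ = -⟪y, hopL W₁ R i v⟫_ℝ := fun y v => real_inner_hopL_comm W₁ R i y v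
  have hB' : ∀ t (y v : Space R), ⟪B t y, v⟫_ℝ = -⟪y, B t v⟫_ℝ := by
    intro t y v
    rw [hBapp, hBapp, real_inner_smul_left, real_inner_smul_right, hHs]; ring
  have hCs : ∀ y v : Space R, ⟪C y, v⟫_ℝ = ⟪y, C v⟫_ℝ := by
    intro y v
    rw [hCapp, hCapp]
    have a1 := hKs y (hopL W₁ R i v)
    have a2 := hHs (indexL R (W₁.phase i).m y) v
    have a3 := hHs y (indexL R (W₁.phase i).m v)
    have a4 := hKs (hopL W₁ R i y) v
    rw [inner_sub_right, inner_sub_left]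
    linarith
  have hKB : ∀ t ∈ Icc t₀ t₁, ∀ y, K (B t y) - B t (K y) = slotEnvelope W₁ i t • C y := by
    intro t _ y
    rw [hKapp, hBapp, hBapp, hKapp, hCapp]
    simp only [RCLike.real_smul_eq_coe_smul (K := ℂ), map_smul, smul_sub]
  have hDp : ∀ t (y : Space R), 0 ≤ ⟪D t y, y⟫_ℝ := fun t y => by rw [hDapp t]; exact real_inner_dampL_nonneg_all h𝔸 hlo'.le hγ₁ y
  have hKD : ∀ t (y : Space R), K (D t y) = D t (K y) := by
    intro t y; rw [hKapp, hDapp t, hDapp t, hKapp, indexL]; exact diagL_dampL_comm R _ 𝔸 γ₁ y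
  have hVK : ∀ y ∈ ladderSub R (ladder z₀ (W₁.phase i).m), K y ∈ ladderSub R (ladder z₀ (W₁.phase i).m) := fun y hy => by rw [hKapp]; exact indexL_mem_ladderSub _ hy
  have hy' : ∀ t ∈ Icc t₀ t₁, HasDerivAt u (B t (u t) - D t (u t)) t := by
    intro t ht
    have h := hu t ht
    have e : ((gen W₁ 𝔸 γ₁ R t).restrictScalars ℝ) (u t) = B t (u t) - D t (u t) := by
      rw [ContinuousLinearMap.coe_restrictScalars', gen_eq_of_slot W₁ 𝔸 γ₁ R i (hoff t ht), hBapp, hDapp t, sub_apply, smul_apply,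
        ← Complex.coe_smul]
    rw [e] at h
    exact h
  -- quantitative hypotheses
  have h1 : ∀ t ∈ Icc t₀ t₁, ∀ y ∈ ladderSub R (ladder z₀ (W₁.phase i).m), 4 * Real.pi ^ 2 * lo' / 7 * ‖K y‖ ^ 2 ≤ ⟪D t y, y⟫_ℝ :=
    fun t _ y hy => by rw [hKapp, hDapp t]; exact inner_dampL_ge_indexL h𝔸 hlo'.le γ₁ hm0 hy
  have h2 : ∀ t ∈ Icc t₀ t₁, ∀ y ∈ ladderSub R (ladder z₀ (W₁.phase i).m), ⟪D t (C y), C y⟫_ℝ ≤ 8 * a ^ 2 * (1 + freqNormSq (W₁.phase i).m) * |hi'| / lo' * ⟪D t y, y⟫_ℝ :=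
    fun t _ y hy => by
      have h := inner_dampL_bond_le W₁ i z₀ h𝔸 hlo' γ₁ hy
      rw [← ha] at h
      rw [hDapp t, hDapp t, hCapp]; exact h
  have h3 : ∀ y ∈ ladderSub R (ladder z₀ (W₁.phase i).m), ‖C y‖ ^ 2 ≤ 4 * a ^ 2 * ‖y‖ ^ 2 := fun y hy => by
    have h := norm_sq_bond_le W₁ i z₀ hy
    rw [← ha] at h
    rw [hCapp]; exact h
  have h4 : ∀ t ∈ Icc t₀ t₁, ∀ y ∈ ladderSub R (ladder z₀ (W₁.phase i).m),
      -(GM * (2 * a ^ 2 * 3 / (((R : ℝ) - M) * (4 * Real.pi ^ 2 * lo'))) * ⟪D t y, y⟫_ℝ + 0 * ⟪D t (K y), K y⟫_ℝ) ≤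
        ⟪K y, C (B t y) - B t (C y)⟫_ℝ := by
    intro t ht y hy
    have hc := inner_indexL_commutator_ge W₁ i z₀ hhop hM hMR h𝔸 hlo' γ₁ hy
    rw [← ha] at hc
    have henv := hG t ht
    have hD0 : 0 ≤ ⟪dampL 𝔸 γ₁ R y, y⟫_ℝ := real_inner_dampL_nonneg_all h𝔸 hlo'.le hγ₁ y
    -- C(B y) − B(C y) = env • (C(Hy) − H(Cy))
    have e : C (B t y) - B t (C y) = slotEnvelope W₁ i t • (indexL R (W₁.phase i).m (hopL W₁ R i (hopL W₁ R i y)) - hopL W₁ R i (indexL R (W₁.phase i).m (hopL W₁ R i y)) -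
        hopL W₁ R i (indexL R (W₁.phase i).m (hopL W₁ R i y) - hopL W₁ R i (indexL R (W₁.phase i).m y))) := by
      rw [hCapp, hBapp, hBapp, hCapp]
      simp only [RCLike.real_smul_eq_coe_smul (K := ℂ), map_smul, map_sub, smul_sub]
    rw [hKapp, hDapp t, e, real_inner_smul_right, zero_mul, add_zero]
    have hη : 0 ≤ 2 * a ^ 2 * 3 / (((R : ℝ) - M) * (4 * Real.pi ^ 2 * lo')) * ⟪dampL 𝔸 γ₁ R y, y⟫_ℝ := by positivity
    have henv0 : 0 ≤ slotEnvelope W₁ i t := hGm.trans henv.1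
    have t1 := mul_le_mul_of_nonneg_left hc henv0
    have t2 := mul_le_mul_of_nonneg_right henv.2 hη
    rw [mul_neg] at t1
    linarith
  have h5 : ∀ t ∈ Icc t₀ t₁, ∀ y ∈ ladderSub R (ladder z₀ (W₁.phase i).m), ‖y‖ ^ 2 ≤
      (1 + freqNormSq (W₁.phase i).m) / (4 * a ^ 2) * (2 + 2 * a ^ 2 / ε) * ‖C y‖ ^ 2 + (1 + freqNormSq (W₁.phase i).m) / (4 * a ^ 2) * (2 * ε) * ‖K y‖ ^ 2 +
        (1 + freqNormSq (W₁.phase i).m) / (4 * a ^ 2) * (2 * a ^ 2 * 3 / (((R : ℝ) - M) * (4 * Real.pi ^ 2 * lo')) + 4 * a ^ 2 / (4 * Real.pi ^ 2 * lo' * ((R : ℝ) - M) ^ 2)) *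
          ⟪D t y, y⟫_ℝ := by
    intro t _ y hy
    have hc := coercive_ladder W₁ i z₀ hhop hM hMR h𝔸 hlo' γ₁ hε hy
    rw [← ha] at hc
    rw [hCapp, hKapp, hDapp t]
    have hpos : 0 < 4 * a ^ 2 / (1 + freqNormSq (W₁.phase i).m) := by have := freqNormSq_nonneg (W₁.phase i).m; positivity
    have hinv : (1 + freqNormSq (W₁.phase i).m) / (4 * a ^ 2) * (4 * a ^ 2 / (1 + freqNormSq (W₁.phase i).m)) = 1 := by
      have := freqNormSq_nonneg (W₁.phase i).m; field_simp
    have := mul_le_mul_of_nonneg_left hc (le_of_lt (by have := freqNormSq_nonneg (W₁.phase i).m; positivity : (0:ℝ) < (1 + freqNormSq (W₁.phase i).m) / (4 * a ^ 2)))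
    rw [← mul_assoc, hinv, one_mul] at this
    linarith
  have h6 : ∀ t ∈ Icc t₀ t₁, ∀ y ∈ ladderSub R (ladder z₀ (W₁.phase i).m),
      (⟪D t y, C (K y)⟫_ℝ - ⟪D t (C (K y)), y⟫_ℝ) + (⟪D t (K y), C y⟫_ℝ - ⟪D t (C y), K y⟫_ℝ) ≤ η₂ * ⟪D t y, y⟫_ℝ + η₃ * ⟪D t (K y), K y⟫_ℝ :=
    fun t _ y hy => by simp only [hDapp t, hCapp, hKapp]; exact hodd y hy
  -- apply the abstract lemma
  have hCJ : 0 < 8 * a ^ 2 * (1 + freqNormSq (W₁.phase i).m) * |hi'| / lo' := by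
    have := freqNormSq_nonneg (W₁.phase i).m; have : 0 < |hi'| := abs_pos.2 hhi.ne'; positivity
  have P4b : 8 * β * (0:ℝ) ≤ α := by rw [mul_zero]; exact hα.le
  have hlo1 : (0:ℝ) < 4 * Real.pi ^ 2 * lo' / 7 := by positivity
  -- The abstract lemma is instantiated at `F := Space R` with all fifteen real constants given explicitly; the hypotheses whose
  -- statements contain NESTED applications of the operators (`K (D t y)`, `D t (C y)`, `C (B t y)`, …) or the vector-space structure
  -- of `Space R` (`-`, `•` on vectors) are threaded through `convert`, which settles the (definitionally equal) instance paths one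
  -- subterm at a time — handing them to the application unifier wholesale is a whnf trap (> 400k heartbeats).
  have L := @LadderCrush.hypocoercive_decay_started'' (Space R) _ _ (ladderSub R (ladder z₀ (W₁.phase i).m)) K C B D
    (fun t => slotEnvelope W₁ i t) u t₀ t₁ δ₁ hδ hδt hB' hCs (fun t ht y => by convert hKB t ht y using 1) hDp (fun t y => by convert hKD t y using 2)
    hVK huV (fun t ht => by convert hy' t ht using 2) Gm GM (4 * Real.pi ^ 2 * lo' / 7) (8 * a ^ 2 * (1 + freqNormSq (W₁.phase i).m) * |hi'| / lo') (4 * a ^ 2)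
    (GM * (2 * a ^ 2 * 3 / (((R : ℝ) - M) * (4 * Real.pi ^ 2 * lo')))) 0 η₂ η₃
    ((1 + freqNormSq (W₁.phase i).m) / (4 * a ^ 2) * (2 + 2 * a ^ 2 / ε)) ((1 + freqNormSq (W₁.phase i).m) / (4 * a ^ 2) * (2 * ε))
    ((1 + freqNormSq (W₁.phase i).m) / (4 * a ^ 2) * (2 * a ^ 2 * 3 / (((R : ℝ) - M) * (4 * Real.pi ^ 2 * lo')) + 4 * a ^ 2 / (4 * Real.pi ^ 2 * lo' * ((R : ℝ) - M) ^ 2)))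
    α β lam hG hGm hlo1 hCJ hα hβ hlam h1 (fun t ht y hy => by convert h2 t ht y hy using 2) h3
    (fun t ht y hy => by convert h4 t ht y hy using 2) h5 (fun t ht y hy => by convert h6 t ht y hy using 2)
    P1 P2 P3 P4 P4b P4c P4d P5 P6 P7 P8
  exact L

end Summit.AnomalousDissipation.AnomalousDissipation.Theorems.SolenoidalFractalHomogenisation.LagrangianStep.Sideband

end
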